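import Literature.MathematicalPhysics.QuantumLattice.GrassmannLaplacianScriptBound
import HarnessLib

/-!
# Determinant-bounded covariances: the hypothesis of the single-scale step beyond Gram form (Pedra–Salmhofer)

Topic `MathematicalPhysics/QuantumLattice`; an interface file for the Laplacian-host engine
(`GrassmannLaplacianScriptBound` → `GrassmannLaplacianTruncatedBound` → `GrassmannCumulant*Bound` → `GrassmannEffectiveActionBound`).
That chain is stated for a charged covariance whose two-point function is in GRAM form on the mixed pairs,
`contr C X̄ Y = ⟪f X̄, g Y⟫`, `‖f‖, ‖g‖ ≤ κ`, and the Gram form enters in exactly ONE estimate: for every script and every real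
interpolation parameter, `‖∫ dμ_{C_{s,t}} ψ(Z₁)⋯ψ(Z_N)‖ ≤ κ^N` (`norm_gaussExpect_scriptCov_genProd_le`), where the interpolated
covariance `C_{s,t} = scriptCov C cl s t` is `C` with its entries multiplied by inner products `⟨U_{cl X}, U_{cl Y}⟩` of real vectors of
norm `≤ 1` (`Script.exists_unit_gram`).  The time-ordered free propagator of lattice fermions at positive temperature is NOT of Gram
form with temperature-independent constants (de Siqueira Pedra–Salmhofer 2008, Lemma 2.2), but it obeys a DETERMINANT BOUND for all
Gram-weighted minors (loc. cit. Thm 1.3 / Thm 2.4; tree: `ChronologicalGramBound`, `MatsubaraDeterminantBound`).  This file isolates the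
weaker hypothesis the engine actually consumes and proves that Gram form implies it:

* `gramWeighted U C` — the covariance `C` with entries multiplied by `⟨U X, U Y⟩_ℝ` (`U : Γ → ℝⁿ`); `contr_gramWeighted`,
  `gramWeighted_apply_of_charge_eq`;
* **`IsGramBounded C κ`** — for every weight family of norm `≤ 1` and every label string,
  `‖∫ dμ_{gramWeighted U C} ψ(Z₁)⋯ψ(Z_N)‖ ≤ κ^N` (exactly what `norm_kernel_treeFactor_genProd_le` uses);
* **`IsDetBounded q C δ`** — every Gram-weighted mixed minor of the two-point function has `‖det[⟨U X̄ᵢ, U Y_j⟩ contr C X̄ᵢ Y_j]‖ ≤ δ^{2a}`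
  (the determinant bound of Pedra–Salmhofer 2008, (1.3)/(2.17), in the block form of `gaussExpect_genProd_mul_genProd`);
* **`IsDetBounded.isGramBounded`** — a charged determinant-bounded covariance is Gram-bounded (sort the string into block form,
  `gaussExpect_genProd_mul_genProd`, the `U(1)` selection rule; the proof of `norm_gaussExpect_genProd_le` with the Gram–Hadamard step
  replaced by the hypothesis);
* `isDetBounded_of_gram`, `isGramBounded_of_gram` — Gram form with constant `κ` gives both, with the same constant (tensoring
  `FermionicTree.tens` and Gram–Hadamard `norm_det_inner_le_prod_norm_mul_prod_norm`);
* `exists_scriptCov_eq_gramWeighted` — the interpolated covariance of a valid script IS a Gram-weighted covariance with weights of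
  norm `≤ 1`; hence **`norm_gaussExpect_scriptCov_genProd_le_of_isGramBounded`** — the one estimate of the chain under `IsGramBounded`.

Everything is proved; the three definitions are the only new objects; no named facts.

## Sources

W. de Siqueira Pedra, M. Salmhofer, Comm. Math. Phys. 282 (2008) 797–818, Thm 1.3, Lemma 2.2, Thm 2.4 [`PedraSalmhofer2008`];
G. Benfatto, A. Giuliani, V. Mastropietro, Ann. Henri Poincaré 7 (2006) 809–898, (2.67), (2.80) [`BenfattoGiulianiMastropietro2006`];
J. Feldman, H. Knörrer, E. Trubowitz, Commun. Math. Phys. 247 (2004) 195–242, App. B [`FeldmanKnorrerTrubowitz2004`].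
-/

noncomputable section

namespace Literature.MathematicalPhysics.QuantumLattice

open GrassmannAlgebra Finset MvPolynomial Literature.Probability.LatticeModels Literature.Probability.LatticeModels.BattleFederbush
open Literature.MeasureTheory.Integral
open scoped InnerProductSpace

/-! ### Gram-weighted covariances and the two hypotheses -/

section Defs

variable {𝕜 : Type*} [RCLike 𝕜] {Γ : Type*}

/-- The **Gram-weighted covariance** `(⟨U X, U Y⟩_ℝ · C X Y)_{X,Y}` for a family of real weight vectors `U : Γ → ℝⁿ` (the form of
every interpolated covariance of the Battle–Brydges–Federbush formula, BGM 2006 (2.67): `t_{i,i'} = u_i · u_{i'}`).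
[cite: BenfattoGiulianiMastropietro2006, (2.67)] -/
def gramWeighted {n : ℕ} (U : Γ → EuclideanSpace ℝ (Fin n)) (C : Matrix Γ Γ 𝕜) : Matrix Γ Γ 𝕜 :=
  Matrix.of fun X Y => ((⟪U X, U Y⟫_ℝ : ℝ) : 𝕜) * C X Y

/-- Unfolding `gramWeighted`. [cite: BenfattoGiulianiMastropietro2006, (2.67)] -/
theorem gramWeighted_apply {n : ℕ} (U : Γ → EuclideanSpace ℝ (Fin n)) (C : Matrix Γ Γ 𝕜) (X Y : Γ) :
    gramWeighted U C X Y = ((⟪U X, U Y⟫_ℝ : ℝ) : 𝕜) * C X Y := rfl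

/-- A charged covariance stays charged under Gram weights. [cite: BenfattoGiulianiMastropietro2006, (2.67)] -/
theorem gramWeighted_apply_of_charge_eq {n : ℕ} (U : Γ → EuclideanSpace ℝ (Fin n)) (q : Γ → Bool) (C : Matrix Γ Γ 𝕜)
    (hC : ∀ X Y, q X = q Y → C X Y = 0) (X Y : Γ) (h : q X = q Y) : gramWeighted U C X Y = 0 := by
  rw [gramWeighted_apply, hC X Y h, mul_zero]

/-- The two-point function of the weighted covariance is the weighted two-point function (the weights are symmetric).
[cite: BenfattoGiulianiMastropietro2006, (2.67)] -/
theorem contr_gramWeighted [Fintype Γ] {n : ℕ} (U : Γ → EuclideanSpace ℝ (Fin n)) (C : Matrix Γ Γ 𝕜) (X Y : Γ) :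
    contr 𝕜 (gramWeighted U C) X Y = ((⟪U X, U Y⟫_ℝ : ℝ) : 𝕜) * contr 𝕜 C X Y := by
  rw [contr_apply, contr_apply, gramWeighted_apply, gramWeighted_apply, real_inner_comm (U X) (U Y), mul_sub, mul_sub]
  ring

variable [Fintype Γ] [DecidableEq Γ]

/-- **Gram-bounded covariance with constant `κ`**: for every family of real weight vectors of norm `≤ 1` and every label string,
the Gaussian expectation of the monomial w.r.t. the weighted covariance is at most `κ^N` — the single estimate the Laplacian-host
engine consumes (BGM 2006, (2.80) for all interpolated covariances (2.67)). [cite: BenfattoGiulianiMastropietro2006, (2.80)] -/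
def IsGramBounded (C : Matrix Γ Γ 𝕜) (κ : ℝ) : Prop :=
  ∀ (n : ℕ) (U : Γ → EuclideanSpace ℝ (Fin n)), (∀ X, ‖U X‖ ≤ 1) →
    ∀ (N : ℕ) (Z : Fin N → Γ), ‖gaussExpect 𝕜 (gramWeighted U C) (genProd 𝕜 Z)‖ ≤ κ ^ N

/-- **Determinant-bounded charged covariance with constant `δ`** (de Siqueira Pedra–Salmhofer 2008, Thm 1.3 / (2.17), in block form):
every Gram-weighted mixed minor of the two-point function, rows at barred labels (`q = true`) and columns at unbarred ones, obeys
`‖det [⟨U X̄ᵢ, U Y_j⟩ · contr C X̄ᵢ Y_j]‖ ≤ δ^a · δ^a`, for all weight families of norm `≤ 1`. [cite: PedraSalmhofer2008, Thm 1.3] -/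
def IsDetBounded (q : Γ → Bool) (C : Matrix Γ Γ 𝕜) (δ : ℝ) : Prop :=
  ∀ (n : ℕ) (U : Γ → EuclideanSpace ℝ (Fin n)), (∀ X, ‖U X‖ ≤ 1) →
    ∀ (a : ℕ) (Xb Xu : Fin a → Γ), (∀ i, q (Xb i) = true) → (∀ j, q (Xu j) = false) →
      ‖(Matrix.of fun i j => ((⟪U (Xb i), U (Xu j)⟫_ℝ : ℝ) : 𝕜) * contr 𝕜 C (Xb i) (Xu j)).det‖ ≤ δ ^ a * δ ^ a

end Defs

/-! ### Determinant-bounded ⇒ Gram-bounded; Gram form ⇒ both -/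

section Implications

variable {𝕜 : Type*} [RCLike 𝕜] {E : Type*} [NormedAddCommGroup E] [InnerProductSpace 𝕜 E]
variable {Γ : Type*} [Fintype Γ] [DecidableEq Γ]

/-- **A charged determinant-bounded covariance is Gram-bounded** (Pedra–Salmhofer 2008, (1.3) ⇒ the `n!`-free bound for every monomial):
sort the string into block form `ψ̄⋯ψ̄ ψ⋯ψ` (a sign), apply the determinant rule `gaussExpect_genProd_mul_genProd` to the weighted
covariance and the hypothesis; unbalanced strings vanish by the `U(1)` selection rule. [cite: PedraSalmhofer2008, Thm 1.3] -/
theorem IsDetBounded.isGramBounded {q : Γ → Bool} {C : Matrix Γ Γ 𝕜} {δ : ℝ} (hC : ∀ X Y, q X = q Y → C X Y = 0) (hδ : 0 ≤ δ)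
    (hDB : IsDetBounded q C δ) : IsGramBounded C δ := by
  intro n U hU N Z
  set p : Fin N → Prop := fun i => q (Z i) = true with hp
  set a := (univ.filter fun i => p i).card with ha
  set b := (univ.filter fun i => ¬ p i).card with hb
  have hN : a + b = N := by rw [ha, hb, card_filter_add_card_filter_not, card_univ, Fintype.card_fin]
  have hCU : ∀ X Y, q X = q Y → gramWeighted U C X Y = 0 := gramWeighted_apply_of_charge_eq U q C hC
  by_cases hab : b = a
  · -- balanced: sort into block form `ψ̄⋯ψ̄ ψ⋯ψ`
    have hca : Fintype.card {i // p i} = a := by rw [Fintype.card_subtype]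
    have hcb : Fintype.card {i // ¬ p i} = a := by rw [Fintype.card_subtype, ← hab]
    set e₁ : {i // p i} ≃ Fin a := Fintype.equivFinOfCardEq hca with he₁
    set e₂ : {i // ¬ p i} ≃ Fin a := Fintype.equivFinOfCardEq hcb with he₂
    set Xb : Fin a → Γ := fun i => Z (e₁.symm i) with hXb
    set Xu : Fin a → Γ := fun j => Z (e₂.symm j) with hXu
    set σ : Fin N ≃ Fin a ⊕ Fin a := (Equiv.sumCompl p).symm.trans (e₁.sumCongr e₂) with hσ
    have haa : a + a = N := by rw [← hN, hab]
    set ρ : Equiv.Perm (Fin N) := (σ.trans finSumFinEquiv).trans (finCongr haa) with hρ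
    have hZ : Z = (Fin.append Xb Xu ∘ (finCongr haa).symm) ∘ ρ := by
      have hsymm : ∀ x : Fin a ⊕ Fin a, Z (σ.symm x) = Fin.append Xb Xu (finSumFinEquiv x) := by
        rintro (i | j)
        · rw [finSumFinEquiv_apply_left, Fin.append_left, hσ, Equiv.symm_trans_apply, Equiv.symm_symm,
            Equiv.sumCongr_symm, Equiv.sumCongr_apply, Sum.map_inl, Equiv.sumCompl_apply_inl]
        · rw [finSumFinEquiv_apply_right, Fin.append_right, hσ, Equiv.symm_trans_apply, Equiv.symm_symm,
            Equiv.sumCongr_symm, Equiv.sumCongr_apply, Sum.map_inr, Equiv.sumCompl_apply_inr]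
      funext i
      have h := hsymm (σ i)
      rw [Equiv.symm_apply_apply] at h
      rw [h, hρ]
      simp only [Function.comp_apply, Equiv.trans_apply, Equiv.symm_apply_apply]
    have hb1 : ∀ i, q (Xb i) = true := fun i => (e₁.symm i).2
    have hu1 : ∀ j, q (Xu j) = false := fun j => Bool.eq_false_iff.2 (e₂.symm j).2
    have hbb : ∀ i j, contr 𝕜 (gramWeighted U C) (Xb i) (Xb j) = 0 := by
      intro i j
      rw [contr_apply, hCU _ _ ((hb1 j).trans (hb1 i).symm), hCU _ _ ((hb1 i).trans (hb1 j).symm), sub_self, mul_zero]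
    have hdet := gaussExpect_genProd_mul_genProd 𝕜 (gramWeighted U C) Xb Xu hbb
    have hentry : (Matrix.of fun i j => contr 𝕜 (gramWeighted U C) (Xb i) (Xu j)) =
        Matrix.of fun i j => ((⟪U (Xb i), U (Xu j)⟫_ℝ : ℝ) : 𝕜) * contr 𝕜 C (Xb i) (Xu j) := by
      ext i j
      exact contr_gramWeighted U C _ _
    rw [hZ, genProd_comp_perm, map_smul, finCongr_symm, genProd_comp_finCongr, genProd_append, hdet, smul_eq_mul,
      norm_intCast_units_smul, norm_mul, norm_pow, norm_neg, norm_one, one_pow, one_mul, hentry]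
    calc ‖(Matrix.of fun i j => ((⟪U (Xb i), U (Xu j)⟫_ℝ : ℝ) : 𝕜) * contr 𝕜 C (Xb i) (Xu j)).det‖
        ≤ δ ^ a * δ ^ a := hDB n U hU a Xb Xu hb1 hu1
      _ = δ ^ N := by rw [← pow_add, haa]
  · -- unbalanced: zero
    rw [gaussExpect_genProd_eq_zero_of_charge 𝕜 q (gramWeighted U C) hCU Z (Ne.symm hab), norm_zero]
    exact pow_nonneg hδ N

omit [Fintype Γ] [DecidableEq Γ] in
/-- **Gram form implies the determinant bound** (Gram–Hadamard for the tensor vectors `U X ⊗ f X`, `U Y ⊗ g Y`; BGM 2006, (2.80)).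
[cite: BenfattoGiulianiMastropietro2006, (2.80)] -/
theorem isDetBounded_of_gram (q : Γ → Bool) (C : Matrix Γ Γ 𝕜) (f g : Γ → E) {κ : ℝ} (hκ : 0 ≤ κ)
    (hf : ∀ X, q X = true → ‖f X‖ ≤ κ) (hg : ∀ Y, q Y = false → ‖g Y‖ ≤ κ)
    (hG : ∀ X Y, q X = true → q Y = false → contr 𝕜 C X Y = ⟪f X, g Y⟫_𝕜) : IsDetBounded q C κ := by
  intro n U hU a Xb Xu hb hu
  have hentry : (Matrix.of fun i j => ((⟪U (Xb i), U (Xu j)⟫_ℝ : ℝ) : 𝕜) * contr 𝕜 C (Xb i) (Xu j)) =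
      Matrix.of fun i j => ⟪FermionicTree.tens 𝕜 (U (Xb i)) (f (Xb i)), FermionicTree.tens 𝕜 (U (Xu j)) (g (Xu j))⟫_𝕜 := by
    ext i j
    simp only [Matrix.of_apply, hG _ _ (hb i) (hu j), FermionicTree.inner_tens]
  rw [hentry]
  refine (Literature.Analysis.InnerProduct.norm_det_inner_le_prod_norm_mul_prod_norm _ _).trans ?_
  calc (∏ i, ‖FermionicTree.tens 𝕜 (U (Xb i)) (f (Xb i))‖) * ∏ j, ‖FermionicTree.tens 𝕜 (U (Xu j)) (g (Xu j))‖
      ≤ (∏ _i : Fin a, κ) * ∏ _j : Fin a, κ := by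
        refine mul_le_mul (prod_le_prod (fun _ _ => norm_nonneg _) fun i _ => ?_)
          (prod_le_prod (fun _ _ => norm_nonneg _) fun j _ => ?_) (prod_nonneg fun _ _ => norm_nonneg _) (prod_nonneg fun _ _ => hκ)
        · rw [FermionicTree.norm_tens]
          exact (mul_le_mul (hU _) (hf _ (hb i)) (norm_nonneg _) zero_le_one).trans (by rw [one_mul])
        · rw [FermionicTree.norm_tens]
          exact (mul_le_mul (hU _) (hg _ (hu j)) (norm_nonneg _) zero_le_one).trans (by rw [one_mul])
    _ = κ ^ a * κ ^ a := by simp only [prod_const, card_univ, Fintype.card_fin]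


/-- **Gram form implies Gram-boundedness** with the same constant. [cite: BenfattoGiulianiMastropietro2006, (2.80)] -/
theorem isGramBounded_of_gram (q : Γ → Bool) (C : Matrix Γ Γ 𝕜) (hC : ∀ X Y, q X = q Y → C X Y = 0) (f g : Γ → E) {κ : ℝ}
    (hκ : 0 ≤ κ) (hf : ∀ X, q X = true → ‖f X‖ ≤ κ) (hg : ∀ Y, q Y = false → ‖g Y‖ ≤ κ)
    (hG : ∀ X Y, q X = true → q Y = false → contr 𝕜 C X Y = ⟪f X, g Y⟫_𝕜) : IsGramBounded C κ :=
  (isDetBounded_of_gram q C f g hκ hf hg hG).isGramBounded hC hκ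

/-- A Gram-bounded covariance has, with the trivial weights, `‖∫ dμ_C ψ(Z)‖ ≤ κ^N` for every string. [cite: BenfattoGiulianiMastropietro2006, (2.80)] -/
theorem IsGramBounded.norm_gaussExpect_genProd_le {C : Matrix Γ Γ 𝕜} {κ : ℝ} (h : IsGramBounded C κ) {N : ℕ} (Z : Fin N → Γ) :
    ‖gaussExpect 𝕜 C (genProd 𝕜 Z)‖ ≤ κ ^ N := by
  -- constant unit weight in `ℝ¹`
  set U : Γ → EuclideanSpace ℝ (Fin 1) := fun _ => EuclideanSpace.single 0 1 with hU
  have hU1 : ∀ X, ‖U X‖ ≤ 1 := fun X => by rw [hU]; simp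
  have hW : gramWeighted U C = C := by
    ext X Y
    rw [gramWeighted_apply, hU]
    simp
  simpa [hW] using h 1 U hU1 N Z

end Implications

/-! ### The interpolated covariance of a script is Gram-weighted -/

section ScriptCov

variable {𝕜 : Type*} [RCLike 𝕜] {Γ : Type*} [Fintype Γ] [DecidableEq Γ] {ι : Type*} [Fintype ι] [DecidableEq ι]
variable (C : Matrix Γ Γ 𝕜) (cl : Γ → ι) {v : ι} {k : ℕ}

omit [Fintype Γ] [DecidableEq Γ] [Fintype ι] in
/-- **The interpolated covariance of a valid script at a point of the cube is a Gram-weighted covariance** with weights of norm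
`≤ 1`: `C_{s,t} = gramWeighted (U ∘ cl) C`, `U` the Gram vectors of `Script.exists_unit_gram` at the points of the script and `0`
elsewhere (BGM 2006, (2.67)). [cite: BenfattoGiulianiMastropietro2006, (2.67)] -/
theorem exists_scriptCov_eq_gramWeighted (s : Script v k) (hs : s.Valid) {t : ι → ℝ} (ht : t ∈ unitCube ι) :
    ∃ U : ι → EuclideanSpace ℝ (Fin (k + 1)), (∀ a, ‖U a‖ ≤ 1) ∧ scriptCov C cl s t = gramWeighted (U ∘ cl) C := by
  classical
  obtain ⟨u, hu1, hu⟩ := Script.exists_unit_gram s hs t fun x => (mem_unitCube.1 ht) x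
  set U : ι → EuclideanSpace ℝ (Fin (k + 1)) := fun a =>
    if h : ∃ i, s.y i = a then u (Classical.choose h) else 0 with hU
  have hUy : ∀ i, U (s.y i) = u i := by
    intro i
    have h : ∃ j, s.y j = s.y i := ⟨i, rfl⟩
    rw [hU]; dsimp only; rw [dif_pos h, Script.y_injective s hs (Classical.choose_spec h)]
  have hUnorm : ∀ a, ‖U a‖ ≤ 1 := by
    intro a
    rw [hU]; dsimp only
    split_ifs with h
    · exact (hu1 _).le
    · rw [norm_zero]; exact zero_le_one
  have hp : ∀ a b : ι, (if insideB (univ.image s.y) s(a, b) = true then ((eval t (s.livePt ℝ s(a, b)) : ℝ) : 𝕜) else 0) =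
      ((⟪U a, U b⟫_ℝ : ℝ) : 𝕜) := by
    intro a b
    split_ifs with h
    · obtain ⟨ha, hb⟩ : a ∈ univ.image s.y ∧ b ∈ univ.image s.y := by
        have h' := (insideB_eq_true_iff _ _).1 h
        exact ⟨h' a (Sym2.mem_mk_left _ _), h' b (Sym2.mem_mk_right _ _)⟩
      obtain ⟨i, -, rfl⟩ := mem_image.1 ha
      obtain ⟨j, -, rfl⟩ := mem_image.1 hb
      rw [← Script.decPt_mk_of_mem_of_mem s ha hb, hu i j, hUy, hUy]
    · have h' : ¬ (a ∈ univ.image s.y ∧ b ∈ univ.image s.y) := fun hab =>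
        h ((insideB_eq_true_iff _ _).2 fun w hw => by rcases Sym2.mem_iff.1 hw with rfl | rfl; exacts [hab.1, hab.2])
      rcases not_and_or.1 h' with ha | hb
      · have hUa : U a = 0 := by rw [hU]; dsimp only; rw [dif_neg]; rintro ⟨i, rfl⟩; exact ha (mem_image_of_mem _ (mem_univ _))
        rw [hUa, inner_zero_left, RCLike.ofReal_zero]
      · have hUb : U b = 0 := by rw [hU]; dsimp only; rw [dif_neg]; rintro ⟨i, rfl⟩; exact hb (mem_image_of_mem _ (mem_univ _))
        rw [hUb, inner_zero_right, RCLike.ofReal_zero]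
  refine ⟨U, hUnorm, ?_⟩
  ext X Y
  rw [scriptCov, scaleByType_apply, hp, gramWeighted_apply, Function.comp_apply, Function.comp_apply]

omit [Fintype ι] in
/-- **The one estimate of the single-scale chain under `IsGramBounded`**: for a valid script and real parameters in the cube,
`‖∫ dμ_{C_{s,t}} ψ(Z₁)⋯ψ(Z_N)‖ ≤ κ^N` (BGM 2006, (2.80); replaces `norm_gaussExpect_scriptCov_genProd_le`, whose Gram hypothesis is the
special case `isGramBounded_of_gram`). [cite: BenfattoGiulianiMastropietro2006, (2.80)] -/
theorem norm_gaussExpect_scriptCov_genProd_le_of_isGramBounded {κ : ℝ} (hGB : IsGramBounded C κ)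
    (s : Script v k) (hs : s.Valid) {t : ι → ℝ} (ht : t ∈ unitCube ι) {N : ℕ} (Z : Fin N → Γ) :
    ‖gaussExpect 𝕜 (scriptCov C cl s t) (genProd 𝕜 Z)‖ ≤ κ ^ N := by
  classical
  obtain ⟨U, hU, hcov⟩ := exists_scriptCov_eq_gramWeighted C cl s hs ht
  rw [hcov]
  exact hGB (k + 1) (U ∘ cl) (fun X => hU (cl X)) N Z

end ScriptCov

/-! ### Replica-stable forms: pulled-back covariances and position-indexed weights

The cumulant bounds of the chain (`GrassmannCumulantKernelBound`, `GrassmannLaplacianVacuumBound`) run the tree estimate on the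
REPLICA covariance `C.submatrix Prod.snd Prod.snd` on `Fin n × Γ` (`n` fully correlated copies of the fields).  A Gram form pulls
back trivially (`f ∘ Prod.snd`); for the determinant bound the weights must then be attached to the ROWS and COLUMNS of the minor
rather than to the labels (two copies of the same label carry different interpolation weights).  Hence the replica-stable forms
below, which are what the twin chain consumes; Gram form and the Pedra–Salmhofer bound (whose tensoring is row/column-wise) give them
all the same. -/

section Replica

universe u

variable {𝕜 : Type*} [RCLike 𝕜] {E : Type*} [NormedAddCommGroup E] [InnerProductSpace 𝕜 E]
variable {Γ : Type u} [Fintype Γ] [DecidableEq Γ]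

/-- **Replica-stable Gram-boundedness**: every pull-back `C.submatrix e e` along a map `e : Γ' → Γ` from a finite label type is
Gram-bounded with constant `κ` (BGM 2006, (2.80) for the interpolated replica covariances of (2.13)–(2.14)).
[cite: BenfattoGiulianiMastropietro2006, (2.80)] -/
def IsGramBoundedR (C : Matrix Γ Γ 𝕜) (κ : ℝ) : Prop :=
  ∀ ⦃Γ' : Type u⦄ [Fintype Γ'] [DecidableEq Γ'] (e : Γ' → Γ), IsGramBounded (C.submatrix e e) κ

/-- **Replica-stable determinant bound** (de Siqueira Pedra–Salmhofer 2008, Thm 1.3 / (2.17) with the Gram weights attached to rows and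
columns): for weight vectors `u_i, u'_j` of norm `≤ 1` and mixed labels, `‖det [⟨u_i, u'_j⟩ · contr C X̄ᵢ Y_j]‖ ≤ δ^a · δ^a`.
[cite: PedraSalmhofer2008, Thm 1.3] -/
def IsDetBoundedR (q : Γ → Bool) (C : Matrix Γ Γ 𝕜) (δ : ℝ) : Prop :=
  ∀ (n a : ℕ) (u u' : Fin a → EuclideanSpace ℝ (Fin n)), (∀ i, ‖u i‖ ≤ 1) → (∀ j, ‖u' j‖ ≤ 1) →
    ∀ (Xb Xu : Fin a → Γ), (∀ i, q (Xb i) = true) → (∀ j, q (Xu j) = false) →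
      ‖(Matrix.of fun i j => ((⟪u i, u' j⟫_ℝ : ℝ) : 𝕜) * contr 𝕜 C (Xb i) (Xu j)).det‖ ≤ δ ^ a * δ ^ a

omit [Fintype Γ] [DecidableEq Γ] in
/-- The two-point function of a pulled-back covariance is the pulled-back two-point function. [cite: BenfattoGiulianiMastropietro2006, (2.13)] -/
theorem contr_submatrix_eq {Γ' : Type*} [Fintype Γ'] (C : Matrix Γ Γ 𝕜) (e : Γ' → Γ) (X' Y' : Γ') :
    contr 𝕜 (C.submatrix e e) X' Y' = contr 𝕜 C (e X') (e Y') := by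
  simp [contr_apply]

/-- A replica-Gram-bounded covariance is Gram-bounded (`e = id`). [cite: BenfattoGiulianiMastropietro2006, (2.80)] -/
theorem IsGramBoundedR.isGramBounded {C : Matrix Γ Γ 𝕜} {κ : ℝ} (h : IsGramBoundedR C κ) : IsGramBounded C κ := by
  simpa using h (id : Γ → Γ)

omit [Fintype Γ] [DecidableEq Γ] in
/-- Replica-Gram-boundedness is stable under pull-back. [cite: BenfattoGiulianiMastropietro2006, (2.80)] -/
theorem IsGramBoundedR.submatrix {C : Matrix Γ Γ 𝕜} {κ : ℝ} (h : IsGramBoundedR C κ) {Γ' : Type u} [Fintype Γ'] [DecidableEq Γ']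
    (e : Γ' → Γ) : IsGramBoundedR (C.submatrix e e) κ := by
  intro Γ'' _ _ e'
  rw [Matrix.submatrix_submatrix]
  exact h (e ∘ e')

omit [Fintype Γ] [DecidableEq Γ] in
/-- The position-weighted determinant bound is stable under pull-back (the charge map pulls back with the labels).
[cite: PedraSalmhofer2008, Thm 1.3] -/
theorem IsDetBoundedR.submatrix [Fintype Γ] {q : Γ → Bool} {C : Matrix Γ Γ 𝕜} {δ : ℝ} (h : IsDetBoundedR q C δ)
    {Γ' : Type*} [Fintype Γ'] (e : Γ' → Γ) : IsDetBoundedR (q ∘ e) (C.submatrix e e) δ := by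
  intro n a u u' hu hu' Xb Xu hb hub
  have hm : (Matrix.of fun i j => ((⟪u i, u' j⟫_ℝ : ℝ) : 𝕜) * contr 𝕜 (C.submatrix e e) (Xb i) (Xu j)) =
      Matrix.of fun i j => ((⟪u i, u' j⟫_ℝ : ℝ) : 𝕜) * contr 𝕜 C ((e ∘ Xb) i) ((e ∘ Xu) j) := by
    ext i j
    rw [Matrix.of_apply, Matrix.of_apply, contr_submatrix_eq, Function.comp_apply, Function.comp_apply]
  rw [hm]
  exact h n a u u' hu hu' (e ∘ Xb) (e ∘ Xu) hb hub

omit [Fintype Γ] [DecidableEq Γ] in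
/-- The position-weighted determinant bound implies the label-weighted one (weights `u_i = U X̄ᵢ`). [cite: PedraSalmhofer2008, Thm 1.3] -/
theorem IsDetBoundedR.isDetBounded {q : Γ → Bool} {C : Matrix Γ Γ 𝕜} {δ : ℝ} (h : IsDetBoundedR q C δ) : IsDetBounded q C δ :=
  fun n U hU a Xb Xu hb hu => h n a (fun i => U (Xb i)) (fun j => U (Xu j)) (fun _ => hU _) (fun _ => hU _) Xb Xu hb hu

omit [DecidableEq Γ] in
/-- **A charged covariance with the replica-stable determinant bound is replica-Gram-bounded** — the hypothesis of the twin chain from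
the Pedra–Salmhofer bound. [cite: PedraSalmhofer2008, Thm 1.3] -/
theorem IsDetBoundedR.isGramBoundedR {q : Γ → Bool} {C : Matrix Γ Γ 𝕜} {δ : ℝ} (hC : ∀ X Y, q X = q Y → C X Y = 0) (hδ : 0 ≤ δ)
    (h : IsDetBoundedR q C δ) : IsGramBoundedR C δ := by
  intro Γ' _ _ e
  exact ((h.submatrix e).isDetBounded).isGramBounded (fun X' Y' hq => hC _ _ hq) hδ

omit [Fintype Γ] [DecidableEq Γ] in
/-- **Gram form implies the replica-stable determinant bound** (Gram–Hadamard with the tensor vectors `u_i ⊗ f X̄ᵢ`, `u'_j ⊗ g Y_j`).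
[cite: BenfattoGiulianiMastropietro2006, (2.80)] -/
theorem isDetBoundedR_of_gram [Fintype Γ] (q : Γ → Bool) (C : Matrix Γ Γ 𝕜) (f g : Γ → E) {κ : ℝ} (hκ : 0 ≤ κ)
    (hf : ∀ X, q X = true → ‖f X‖ ≤ κ) (hg : ∀ Y, q Y = false → ‖g Y‖ ≤ κ)
    (hG : ∀ X Y, q X = true → q Y = false → contr 𝕜 C X Y = ⟪f X, g Y⟫_𝕜) : IsDetBoundedR q C κ := by
  intro n a u u' hu hu' Xb Xu hb hub
  have hentry : (Matrix.of fun i j => ((⟪u i, u' j⟫_ℝ : ℝ) : 𝕜) * contr 𝕜 C (Xb i) (Xu j)) =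
      Matrix.of fun i j => ⟪FermionicTree.tens 𝕜 (u i) (f (Xb i)), FermionicTree.tens 𝕜 (u' j) (g (Xu j))⟫_𝕜 := by
    ext i j
    simp only [Matrix.of_apply, hG _ _ (hb i) (hub j), FermionicTree.inner_tens]
  rw [hentry]
  refine (Literature.Analysis.InnerProduct.norm_det_inner_le_prod_norm_mul_prod_norm _ _).trans ?_
  calc (∏ i, ‖FermionicTree.tens 𝕜 (u i) (f (Xb i))‖) * ∏ j, ‖FermionicTree.tens 𝕜 (u' j) (g (Xu j))‖
      ≤ (∏ _i : Fin a, κ) * ∏ _j : Fin a, κ := by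
        refine mul_le_mul (prod_le_prod (fun _ _ => norm_nonneg _) fun i _ => ?_)
          (prod_le_prod (fun _ _ => norm_nonneg _) fun j _ => ?_) (prod_nonneg fun _ _ => norm_nonneg _) (prod_nonneg fun _ _ => hκ)
        · rw [FermionicTree.norm_tens]
          exact (mul_le_mul (hu _) (hf _ (hb i)) (norm_nonneg _) zero_le_one).trans (by rw [one_mul])
        · rw [FermionicTree.norm_tens]
          exact (mul_le_mul (hu' _) (hg _ (hub j)) (norm_nonneg _) zero_le_one).trans (by rw [one_mul])
    _ = κ ^ a * κ ^ a := by simp only [prod_const, card_univ, Fintype.card_fin]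

omit [DecidableEq Γ] in
/-- **Gram form implies replica-Gram-boundedness** with the same constant. [cite: BenfattoGiulianiMastropietro2006, (2.80)] -/
theorem isGramBoundedR_of_gram (q : Γ → Bool) (C : Matrix Γ Γ 𝕜) (hC : ∀ X Y, q X = q Y → C X Y = 0) (f g : Γ → E) {κ : ℝ}
    (hκ : 0 ≤ κ) (hf : ∀ X, q X = true → ‖f X‖ ≤ κ) (hg : ∀ Y, q Y = false → ‖g Y‖ ≤ κ)
    (hG : ∀ X Y, q X = true → q Y = false → contr 𝕜 C X Y = ⟪f X, g Y⟫_𝕜) : IsGramBoundedR C κ :=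
  (isDetBoundedR_of_gram q C f g hκ hf hg hG).isGramBoundedR hC hκ

end Replica

end Literature.MathematicalPhysics.QuantumLattice

end
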